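import Summits.HodgeConjecture.HodgeCM.Model.ToyG2.Blocks_1

/-! PORT of `HodgeCM/Model/ToyG2/Blocks.lean` (HodgeCMPerL run 82) — part 2: continuation of `Summits.HodgeConjecture.HodgeCM.Model.ToyG2.Blocks_1` (split at a top-level declaration boundary by port_pkg.py; scope re-opened below; declarations unchanged). -/

-- port_pkg: scope re-opened for this part (file-level context, then the namespace/section stack open at the cut)
namespace HodgeCM.ToyG2
open HodgeCM.Toy HodgeCM.Toy.CMPresentation
open scoped TensorProduct
open exteriorPower Obj₂
open Literature.AlgebraicGeometry.Motives
open Literature.AlgebraicGeometry.ShimuraVarieties (conjRingHomK)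
noncomputable section
section Block
variable (L : CMField) (Θ : Fin 4 → CMType L)
variable (ξ : Fin 4 → L)
variable (d t : ℚ)
/-- `ℓ` on a family in slots `a, a, b, b`, `a < b`: the `Eₐ∧E_b`-term alone survives. -/
theorem ell_apply_pair {a b : Fin 4} (hab : a < b) (u u' w w' : FK L) :
    ell L Θ ξ d t ![emb L Θ a u, emb L Θ a u', emb L Θ b w, emb L Θ b w']
      = ellCoef d a b * (E2 L ξ a ![u, u'] * E2 L ξ b ![w, w']) := by
  -- vanishing of `E_{a'} ∧ E_{b'}` whenever `a' ∉ {a,b}` or `b' ∉ {a,b}`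
  have hL : ∀ a' b' : Fin 4, a' ≠ a → a' ≠ b →
      EE L Θ ξ a' b' ![emb L Θ a u, emb L Θ a u', emb L Θ b w, emb L Θ b w'] = 0 := by
    intro a' b' h1 h2
    refine EE_eq_zero_left L Θ ξ a' b' _ ∅ (by simp) fun k _ => ?_
    fin_cases k <;> simp [pr_emb_of_ne L Θ h1.symm, pr_emb_of_ne L Θ h2.symm]
  have hR : ∀ a' b' : Fin 4, b' ≠ a → b' ≠ b →
      EE L Θ ξ a' b' ![emb L Θ a u, emb L Θ a u', emb L Θ b w, emb L Θ b w'] = 0 := by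
    intro a' b' h1 h2
    refine EE_eq_zero_right L Θ ξ a' b' _ ∅ (by simp) fun k _ => ?_
    fin_cases k <;> simp [pr_emb_of_ne L Θ h1.symm, pr_emb_of_ne L Θ h2.symm]
  -- vanishing of `T`: some slot is missing
  have hT : TT L Θ ξ ![emb L Θ a u, emb L Θ a u', emb L Θ b w, emb L Θ b w'] = 0 := by
    obtain ⟨k₀, hk₀a, hk₀b⟩ : ∃ k₀ : Fin 4, k₀ ≠ a ∧ k₀ ≠ b := by
      clear hL hR
      fin_cases a <;> fin_cases b <;> decide
    refine TT_eq_zero_of_slot_missing L Θ ξ _ k₀ fun k => ?_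
    fin_cases k <;> simp [pr_emb_of_ne L Θ hk₀a.symm, pr_emb_of_ne L Θ hk₀b.symm]
  have hP := EE_apply_pair L Θ ξ (ne_of_lt hab) u u' w w'
  simp only [ell, AlternatingMap.add_apply, AlternatingMap.smul_apply, hT, smul_zero, add_zero]
  fin_cases a <;> fin_cases b <;> simp at hL hR hP hab ⊢ <;> simp [hL, hR, hP, ellCoef]

/-- `ℓ` on a family in slots `0, 1, 2, 3`: the twist alone survives. -/
theorem ell_apply_sorted (x : Fin 4 → FK L) :
    ell L Θ ξ d t (fun k => emb L Θ k (x k))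
      = t * Algebra.trace ℚ (FK L) (eK L (ξ 2 * ξ 3) * x 0 * x 1 * cF L (x 2) * cF L (x 3)) := by
  have hE : ∀ a b : Fin 4, a ≠ b → EE L Θ ξ a b (fun k => emb L Θ k (x k)) = 0 := by
    intro a b hab
    refine EE_eq_zero_left L Θ ξ a b _ {a} (by simp) fun k hk => ?_
    rw [Finset.mem_singleton] at hk
    exact pr_emb_of_ne L Θ hk _
  simp only [ell, AlternatingMap.add_apply, AlternatingMap.smul_apply, TT_apply_sorted, smul_eq_mul]
  rw [hE 0 1 (by decide), hE 2 3 (by decide), hE 0 2 (by decide), hE 0 3 (by decide),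
    hE 1 2 (by decide), hE 1 3 (by decide)]
  ring

/-! ### §4 Antisymmetry of the Riemann forms and `ℓ ≠ 0` -/

/-- `Tr(c z) = Tr(z)` on `F_L` -/
theorem trace_cF (z : FK L) : Algebra.trace ℚ (FK L) (cF L z) = Algebra.trace ℚ (FK L) z :=
  trace_conj_eq (cF L) (emb_cF L) z

variable {ξ} in
/-- For `ξ̄ᵢ = -ξᵢ` the twisted trace form is antisymmetric … -/
theorem bil_antisymm (hξ : ∀ i, conjRingHomK L (ξ i) = -ξ i) (i : Fin 4) (u w : FK L) :
    bil L (eK L (ξ i)) w u = - bil L (eK L (ξ i)) u w := by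
  have hc : cF L (eK L (ξ i)) = -eK L (ξ i) := by rw [cF_eK, hξ, map_neg]
  rw [bil_apply, bil_apply, ← trace_cF L (eK L (ξ i) * w * cF L u), map_mul (cF L), map_mul (cF L),
    cF_cF, hc, ← map_neg (Algebra.trace ℚ (FK L))]
  congr 1
  ring

variable {ξ} in
/-- … so `Eᵢ(u, u') = 2 Tr(ξᵢ u ū')`. -/
theorem E2_antisymm_apply (hξ : ∀ i, conjRingHomK L (ξ i) = -ξ i) (i : Fin 4) (v : Fin 2 → FK L) :
    E2 L ξ i v = 2 * Algebra.trace ℚ (FK L) (eK L (ξ i) * v 0 * cF L (v 1)) := by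
  have h := bil_antisymm L hξ i (v 0) (v 1)
  rw [bil_apply, bil_apply] at h
  rw [E2_apply, h]
  ring

variable {ξ} in
/-- `Eᵢ(1, c(ξᵢ⁻¹)) = 2 [L : ℚ]`. -/
theorem E2_one (hξ : ∀ i, conjRingHomK L (ξ i) = -ξ i) (hξ0 : ∀ i, ξ i ≠ 0) (i : Fin 4) :
    E2 L ξ i ![1, cF L (eK L (ξ i))⁻¹] = 2 * Module.finrank ℚ L := by
  have hne : eK L (ξ i) ≠ 0 := (map_ne_zero_iff _ (eK L).injective).mpr (hξ0 i)
  rw [E2_antisymm_apply L hξ]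
  simp only [Matrix.cons_val_zero, Matrix.cons_val_one, cF_cF, mul_one, mul_inv_cancel₀ hne]
  rw [show (1 : FK L) = algebraMap ℚ (FK L) 1 from (map_one _).symm, Algebra.trace_algebraMap, finrank_FK]
  simp

variable {ξ} in
/-- the test value `ℓ(1⁽⁰⁾, c(ξ₀⁻¹)⁽⁰⁾, 1⁽¹⁾, c(ξ₁⁻¹)⁽¹⁾) = 4 [L:ℚ]²` -/
theorem ell_test (hξ : ∀ i, conjRingHomK L (ξ i) = -ξ i) (hξ0 : ∀ i, ξ i ≠ 0) :
    ell L Θ ξ d t ![emb L Θ 0 1, emb L Θ 0 (cF L (eK L (ξ 0))⁻¹), emb L Θ 1 1,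
        emb L Θ 1 (cF L (eK L (ξ 1))⁻¹)]
      = (2 * Module.finrank ℚ L) * (2 * Module.finrank ℚ L) := by
  rw [ell_apply_pair L Θ ξ d t (show (0 : Fin 4) < 1 by decide), E2_one L hξ hξ0, E2_one L hξ hξ0]
  simp [ellCoef]

variable {ξ} in
/-- **The period functional of a block is nonzero** (needed by the Gysin axiom for maps into products
with this block, DESIGN.md §7). -/
theorem ellLin_ne_zero (hξ : ∀ i, conjRingHomK L (ξ i) = -ξ i) (hξ0 : ∀ i, ξ i ≠ 0) :
    ellLin L Θ ξ d t ≠ 0 := by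
  intro h
  have h1 := ell_test L Θ d t hξ hξ0
  rw [← ellLin_apply_ιMulti, h, LinearMap.zero_apply] at h1
  have h2 : (0 : ℚ) < Module.finrank ℚ L := by exact_mod_cast Module.finrank_pos
  nlinarith

variable {ξ} in
/-- (Ported verbatim from the HodgeCMPerL package; no docstring in the source.) -/
theorem pLeaf_ℓ_ne_zero (hξ : ∀ i, conjRingHomK L (ξ i) = -ξ i) (hξ0 : ∀ i, ξ i ≠ 0) :
    (pLeaf L Θ ξ d t).ℓ ≠ 0 :=
  ellLin_ne_zero L Θ d t hξ hξ0

end Block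

end

end HodgeCM.ToyG2
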